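import Literature.Computability.AlgebraicComplexity.SymmetricCircuitFold
import Mathlib.Algebra.Group.Action.Basic
import Mathlib.Data.Fintype.Sum
import Mathlib.Data.Finset.BooleanAlgebra
import Mathlib.Logic.Embedding.Basic
import Mathlib.Logic.Equiv.Sum
import HarnessLib

/-!
# Symmetric circuits: folding an output family along the fibres of an equivariant surjection

Topic `Computability/AlgebraicComplexity`, namespace `Literature.Computability.AlgebraicComplexity`.

A closure property of Dawar–Wilsenach symmetric arithmetic circuits
(`SymmetricArithCircuit.lean`: `LabelledArithCircuit` = Def. 2.2, `IsAutomorphismExtending` =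
Def. 3.6, `IsSymmetric` = Def. 3.7 of A. Dawar, G. Wilsenach, *Symmetric Arithmetic Circuits*,
Theory of Computing 21 (2025)), the FIBREWISE version of `SymmetricCircuitFold.lean`: if a
`Γ`-symmetric labelled circuit `C` over constants `K` and variables `X` computes the family
`(g_y)_{y ∈ Y}` at outputs indexed by a finite `Γ`-set `Y`, and `p : Y → Y'` is a `Γ`-EQUIVARIANT
SURJECTION onto a finite `Γ`-set `Y'`, then the family of FIBRE SUMS
`(Σ_{y : p y = y'} g_y)_{y' ∈ Y'}` (resp. FIBRE PRODUCTS `(Π_{y : p y = y'} g_y)_{y'}`) is computed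
at outputs indexed by `Y'` by a `Γ`-symmetric labelled circuit with exactly `|G| + |Y'|` gates
(`LabelledArithCircuit.IsSymmetric.exists_fibreSum`, `…exists_fibreProd`). Typical uses: row
sums `(Σ_j M_ij)_i` of an equivariant matrix family (`p = Prod.fst`), partial traces, "forgetting
a label" `Σ_v F(ρ[k ↦ v])` in graph-algebra evaluations; `Y' = Unit` recovers the plain fold.

Construction (`LabelledArithCircuit.FibreFold.fibreFoldCircuit C p l hl hsurj`, a
post-composition gadget): gate set `G ⊕ Y'`; the old gates `Sum.inl g` keep their children and
labels (`fibWires`, `fibLabel`); the new gate `Sum.inr y'` carries the internal label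
`l ∈ {+, ×}` (`hl : ¬ l.IsInput`), has as children the output gates of the fibre,
`{Sum.inl (C.output y) : p y = y'}` (`fibOut`; nonempty because `p` is surjective, as Def. 2.2
demands of a `+`/`×` gate; distinct indices give distinct gates, `output_injective`), and is the
output gate indexed `y'`. Semantics (`fibreFoldCircuit_eval_inl`,
`fibreFoldCircuit_eval_output_add`, `fibreFoldCircuit_eval_output_mul`): old values are
unchanged and the new gate `y'` computes `Σ_{p y = y'} g_y` resp. `Π_{p y = y'} g_y`. Symmetry
(`fibreFoldCircuit_isAutomorphismExtending`): an automorphism `π` of `C` extending `γ`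
(Def. 3.6) extends as `π ⊕ (γ • ·)` (`Equiv.sumCongr π (MulAction.toPerm γ)`); the fibre of
`γ • y'` is `γ •` the fibre of `y'` by equivariance (`fibre_smul_eq_map`) and
`π (C.output y) = C.output (γ • y)`, so the children of the new gate `y'` are carried onto those
of the new gate `γ • y'`; its label `+`/`×` is fixed by `γ`. Size: `|G ⊕ Y'| = |G| + |Y'|`.
Everything is folklore and proved; nothing here is a named fact.
-/

noncomputable section

namespace Literature.Computability.AlgebraicComplexity

open MvPolynomial

universe u v w z t

namespace LabelledArithCircuit

namespace FibreFold

variable {K : Type u} {X : Type v} {Y : Type z} {Y' : Type t} {G : Type w}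
  (C : LabelledArithCircuit K X Y G) (p : Y → Y') (l : CircuitLabel K X)

/-! ### The construction -/

/-- The output gates of `C`, as an embedding of `Y` into the new gate set `G ⊕ Y'`
(`y ↦ Sum.inl (C.output y)`; injective by `output_injective`).
[cite: DawarWilsenach2025, Def. 2.2] -/
def fibOut : Y ↪ G ⊕ Y' :=
  ⟨fun y => Sum.inl (C.output y), Sum.inl_injective.comp C.output_injective⟩

/-- `fibOut C y = Sum.inl (C.output y)`. [cite: DawarWilsenach2025, Def. 2.2] -/
@[simp] theorem fibOut_apply (y : Y) : (fibOut C : Y ↪ G ⊕ Y') y = Sum.inl (C.output y) := rfl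

/-- Labels in the fibre-folded circuit: old labels on old gates, and `l` (`+` or `×`) on every
new gate `Sum.inr y'`. [cite: DawarWilsenach2025, Def. 2.2] -/
def fibLabel : G ⊕ Y' → CircuitLabel K X
  | .inl g => C.label g
  | .inr _ => l

variable {l} in
/-- Labels are injective on input gates of the fibre-folded circuit (only old gates are input
gates, the new ones carrying the internal label `l`). [cite: DawarWilsenach2025, Def. 2.2] -/
theorem eq_of_fibLabel_eq (hl : ¬ l.IsInput) (s s' : G ⊕ Y') (hs : (fibLabel C l s).IsInput)
    (hss' : fibLabel C l s = fibLabel C l s') : s = s' := by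
  cases s with
  | inl g =>
    change (C.label g).IsInput at hs
    cases s' with
    | inl g' => exact congrArg Sum.inl (C.eq_of_label_eq g g' hs hss')
    | inr y' =>
      change C.label g = l at hss'
      rw [hss'] at hs
      exact absurd hs hl
  | inr y' => exact absurd hs hl

variable [Fintype Y] [DecidableEq Y']

/-- Wires of the fibre-folded circuit along `p : Y → Y'`: an old gate keeps its children, the
new gate `Sum.inr y'` has as children the output gates of `C` indexed by the fibre
`{y : p y = y'}`. [cite: DawarWilsenach2025, Def. 2.2] -/
def fibWires : G ⊕ Y' → Finset (G ⊕ Y')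
  | .inl g => (C.children g).map Function.Embedding.inl
  | .inr y' => (Finset.univ.filter fun y => p y = y').map (fibOut C)

/-! #### Acyclicity -/

/-- Old gates are accessible for the wires of the fibre-folded circuit (acyclicity of `C`).
[cite: DawarWilsenach2025, Def. 2.2] -/
theorem acc_fibWires_inl (g : G) :
    Acc (fun s s' : G ⊕ Y' => s ∈ fibWires C p s') (.inl g) := by
  induction g using C.wf.induction with
  | h g ih =>
    refine Acc.intro _ fun s hs => ?_
    simp only [fibWires, Finset.mem_map, Function.Embedding.inl_apply] at hs
    obtain ⟨h, hh, rfl⟩ := hs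
    exact ih h hh

/-- The new gates of the fibre-folded circuit are accessible (their children are old gates).
[cite: DawarWilsenach2025, Def. 2.2] -/
theorem acc_fibWires_inr (y' : Y') :
    Acc (fun s s' : G ⊕ Y' => s ∈ fibWires C p s') (.inr y') := by
  refine Acc.intro _ fun s hs => ?_
  simp only [fibWires, Finset.mem_map, fibOut_apply] at hs
  obtain ⟨y, -, rfl⟩ := hs
  exact acc_fibWires_inl C p (C.output y)

/-- The child relation of the fibre-folded circuit is well founded.
[cite: DawarWilsenach2025, Def. 2.2] -/
theorem fibWires_wf : WellFounded fun s s' : G ⊕ Y' => s ∈ fibWires C p s' :=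
  ⟨fun s => match s with
    | .inl g => acc_fibWires_inl C p g
    | .inr y' => acc_fibWires_inr C p y'⟩

/-! #### The labelled circuit -/

variable {l}

/-- Input labels sit exactly at the gates of the fibre-folded circuit without children: the new
gate `Sum.inr y'` is internal and, `p` being surjective, its fibre — hence its set of children —
is nonempty. [cite: DawarWilsenach2025, Def. 2.2] -/
theorem isInput_fibLabel_iff (hl : ¬ l.IsInput) (hsurj : Function.Surjective p) (s : G ⊕ Y') :
    (fibLabel C l s).IsInput ↔ fibWires C p s = ∅ := by
  cases s with
  | inl g => simp only [fibLabel, fibWires, Finset.map_eq_empty]; exact C.isInput_iff g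
  | inr y' =>
    simp only [fibLabel, fibWires, Finset.map_eq_empty]
    obtain ⟨y, hy⟩ := hsurj y'
    exact iff_of_false hl
      (Finset.ne_empty_of_mem (Finset.mem_filter.2 ⟨Finset.mem_univ y, hy⟩))

variable (l)

/-- **The fibre-folded circuit** of `C` along the surjection `p : Y → Y'` with internal label `l`
(module docstring): on top of `C`, one new gate `Sum.inr y'` per `y' ∈ Y'`, labelled `l`
(`+`: the sum, `×`: the product of the outputs of `C` in the fibre of `y'`) over the output gates
`{C.output y : p y = y'}`; it is the output gate indexed `y'`.
[cite: DawarWilsenach2025, Def. 2.2] -/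
def fibreFoldCircuit (hl : ¬ l.IsInput) (hsurj : Function.Surjective p) :
    LabelledArithCircuit K X Y' (G ⊕ Y') where
  children := fibWires C p
  label := fibLabel C l
  output := Sum.inr
  wf := fibWires_wf C p
  isInput_iff := isInput_fibLabel_iff C p hl hsurj
  eq_of_label_eq := eq_of_fibLabel_eq C hl
  output_injective := Sum.inr_injective

variable {C p l} {hl : ¬ l.IsInput} {hsurj : Function.Surjective p}

/-! ### Semantics -/

section Eval

variable [CommSemiring K]

/-- Old gates keep their values in the fibre-folded circuit.
[cite: DawarWilsenach2025, §2 (evaluation)] -/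
theorem fibreFoldCircuit_eval_inl (g : G) :
    (fibreFoldCircuit C p l hl hsurj).eval (.inl g) = C.eval g := by
  induction g using C.wf.induction with
  | h g ih =>
    have hlab : (fibreFoldCircuit C p l hl hsurj).label (.inl g) = C.label g := rfl
    have hch : (fibreFoldCircuit C p l hl hsurj).children (.inl g) =
        (C.children g).map Function.Embedding.inl := rfl
    rcases hg : C.label g with x | c | _ | _
    · rw [C.eval_of_label_var hg, (fibreFoldCircuit C p l hl hsurj).eval_of_label_var
        (hlab.trans hg)]
    · rw [C.eval_of_label_const hg, (fibreFoldCircuit C p l hl hsurj).eval_of_label_const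
        (hlab.trans hg)]
    · rw [C.eval_of_label_add hg, (fibreFoldCircuit C p l hl hsurj).eval_of_label_add
        (hlab.trans hg), hch, Finset.sum_map]
      exact Finset.sum_congr rfl fun h hh => ih h hh
    · rw [C.eval_of_label_mul hg, (fibreFoldCircuit C p l hl hsurj).eval_of_label_mul
        (hlab.trans hg), hch, Finset.prod_map]
      exact Finset.prod_congr rfl fun h hh => ih h hh

/-- **Semantics, fibre sums.** With the label `+` the output `y'` of the fibre-folded circuit
computes `Σ_{y : p y = y'}` of the outputs of `C`. [cite: DawarWilsenach2025, §2 (evaluation)] -/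
theorem fibreFoldCircuit_eval_output_add (hsurj : Function.Surjective p) (y' : Y') :
    (fibreFoldCircuit C p .add CircuitLabel.not_isInput_add hsurj).eval
        ((fibreFoldCircuit C p .add CircuitLabel.not_isInput_add hsurj).output y') =
      ∑ y ∈ Finset.univ.filter (fun y => p y = y'), C.eval (C.output y) := by
  change (fibreFoldCircuit C p .add CircuitLabel.not_isInput_add hsurj).eval (.inr y') = _
  rw [(fibreFoldCircuit C p .add _ hsurj).eval_of_label_add
    (show (fibreFoldCircuit C p .add CircuitLabel.not_isInput_add hsurj).label (.inr y') = .add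
      from rfl)]
  change ∑ h ∈ (Finset.univ.filter fun y => p y = y').map (fibOut C),
    (fibreFoldCircuit C p .add CircuitLabel.not_isInput_add hsurj).eval h = _
  rw [Finset.sum_map]
  exact Finset.sum_congr rfl fun y _ => fibreFoldCircuit_eval_inl (C.output y)

/-- **Semantics, fibre products.** With the label `×` the output `y'` of the fibre-folded circuit
computes `Π_{y : p y = y'}` of the outputs of `C`. [cite: DawarWilsenach2025, §2 (evaluation)] -/
theorem fibreFoldCircuit_eval_output_mul (hsurj : Function.Surjective p) (y' : Y') :
    (fibreFoldCircuit C p .mul CircuitLabel.not_isInput_mul hsurj).eval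
        ((fibreFoldCircuit C p .mul CircuitLabel.not_isInput_mul hsurj).output y') =
      ∏ y ∈ Finset.univ.filter (fun y => p y = y'), C.eval (C.output y) := by
  change (fibreFoldCircuit C p .mul CircuitLabel.not_isInput_mul hsurj).eval (.inr y') = _
  rw [(fibreFoldCircuit C p .mul _ hsurj).eval_of_label_mul
    (show (fibreFoldCircuit C p .mul CircuitLabel.not_isInput_mul hsurj).label (.inr y') = .mul
      from rfl)]
  change ∏ h ∈ (Finset.univ.filter fun y => p y = y').map (fibOut C),
    (fibreFoldCircuit C p .mul CircuitLabel.not_isInput_mul hsurj).eval h = _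
  rw [Finset.prod_map]
  exact Finset.prod_congr rfl fun y _ => fibreFoldCircuit_eval_inl (C.output y)

end Eval

/-! ### Symmetry -/

section Symmetry

variable {Γ : Type*} [Group Γ] [MulAction Γ X] [MulAction Γ Y] [MulAction Γ Y'] {γ : Γ}
  {π : Equiv.Perm G}

/-- Along a `Γ`-equivariant map `p : Y → Y'`, the fibre of `γ • y'` is the translate by `γ` of
the fibre of `y'`. [folklore] -/
theorem fibre_smul_eq_map (hp : ∀ (γ : Γ) (y : Y), p (γ • y) = γ • p y) (γ : Γ) (y' : Y') :
    (Finset.univ.filter fun y => p y = γ • y') =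
      (Finset.univ.filter fun y => p y = y').map
        (MulAction.toPerm γ : Equiv.Perm Y).toEmbedding := by
  ext y
  simp only [Finset.mem_filter, Finset.mem_univ, true_and, Finset.mem_map_equiv,
    MulAction.toPerm_symm_apply, hp, inv_smul_eq_iff]

/-- **Symmetry.** If `π` is an automorphism of `C` extending `γ` then `π ⊕ (γ • ·)` is an
automorphism of the fibre-folded circuit extending `γ`: the output gates of the fibre of `y'` —
the children of the new gate `y'` — are carried onto those of the fibre of `γ • y'`
(`C.output (γ • y) = π (C.output y)` and equivariance of `p`), the new gate `y'` goes to the new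
gate `γ • y'`, and its label `+`/`×` is fixed. [cite: DawarWilsenach2025, Def. 3.6] -/
theorem fibreFoldCircuit_isAutomorphismExtending (hp : ∀ (γ : Γ) (y : Y), p (γ • y) = γ • p y)
    (hπ : C.IsAutomorphismExtending γ π) :
    (fibreFoldCircuit C p l hl hsurj).IsAutomorphismExtending γ
      (Equiv.sumCongr π (MulAction.toPerm γ)) := by
  refine ⟨?_, ?_, fun _ => rfl⟩
  · rintro (g | y')
    · change (C.children (π g)).map Function.Embedding.inl =
        ((C.children g).map Function.Embedding.inl).map
          (Equiv.sumCongr π (MulAction.toPerm γ : Equiv.Perm Y')).toEmbedding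
      rw [hπ.children_apply, Finset.map_map, Finset.map_map]
      rfl
    · change (Finset.univ.filter fun y => p y = γ • y').map (fibOut C) =
        ((Finset.univ.filter fun y => p y = y').map (fibOut C)).map
          (Equiv.sumCongr π (MulAction.toPerm γ : Equiv.Perm Y')).toEmbedding
      have key : (fibOut C).trans
          (Equiv.sumCongr π (MulAction.toPerm γ : Equiv.Perm Y')).toEmbedding =
            (MulAction.toPerm γ : Equiv.Perm Y).toEmbedding.trans (fibOut C) := by
        ext y : 1
        change Sum.inl (π (C.output y)) = Sum.inl (C.output (γ • y))
        rw [hπ.output_smul]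
      rw [Finset.map_map, key, ← Finset.map_map, fibre_smul_eq_map hp]
  · rintro (g | y')
    · exact hπ.label_apply g
    · change l = γ • l
      exact (CircuitLabel.smul_eq_self_of_not_isInput hl γ).symm

/-- A `Γ`-symmetric `C` and a `Γ`-equivariant surjection `p` give a `Γ`-symmetric fibre-folded
circuit (Def. 3.7). [cite: DawarWilsenach2025, Def. 3.7] -/
theorem fibreFoldCircuit_isSymmetric (hp : ∀ (γ : Γ) (y : Y), p (γ • y) = γ • p y)
    (hC : C.IsSymmetric Γ) : (fibreFoldCircuit C p l hl hsurj).IsSymmetric Γ := by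
  intro γ
  obtain ⟨π, hπ⟩ := hC γ
  exact ⟨Equiv.sumCongr π (MulAction.toPerm γ), fibreFoldCircuit_isAutomorphismExtending hp hπ⟩

end Symmetry

end FibreFold

/-- **Fibre sums of symmetric circuits along an equivariant surjection.** For any group `Γ`
acting on the variables `X` and on finite index sets `Y`, `Y'`, and a `Γ`-equivariant surjection
`p : Y → Y'`: if a `Γ`-symmetric labelled circuit `C` over `K`, `X` computes `(g_y)_{y ∈ Y}`,
then the family of fibre sums `(Σ_{y : p y = y'} g_y)_{y' ∈ Y'}` is computed at outputs indexed by
`Y'` by a `Γ`-symmetric labelled circuit on at most `|G| + |Y'|` gates (one new `+` gate per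
`y'` over the output gates of its fibre, `FibreFold.fibreFoldCircuit`; Dawar–Wilsenach Defs. 2.2,
3.6, 3.7). [cite: DawarWilsenach2025, Def. 3.7] -/
theorem IsSymmetric.exists_fibreSum {K : Type u} [CommSemiring K] {X : Type v} {Y : Type z}
    {Y' : Type t} [Fintype Y] [Fintype Y'] [DecidableEq Y'] {G : Type w} [Fintype G]
    {Γ : Type*} [Group Γ] [MulAction Γ X] [MulAction Γ Y] [MulAction Γ Y']
    {C : LabelledArithCircuit K X Y G} (hC : C.IsSymmetric Γ) (p : Y → Y')
    (hp : ∀ (γ : Γ) (y : Y), p (γ • y) = γ • p y) (hsurj : Function.Surjective p) :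
    ∃ (G' : Type (max w t)) (_ : Fintype G') (C' : LabelledArithCircuit K X Y' G'),
      C'.IsSymmetric Γ ∧
      (∀ y', C'.eval (C'.output y') =
        ∑ y ∈ Finset.univ.filter (fun y => p y = y'), C.eval (C.output y)) ∧
      Fintype.card G' ≤ Fintype.card G + Fintype.card Y' :=
  ⟨G ⊕ Y', inferInstance, FibreFold.fibreFoldCircuit C p .add CircuitLabel.not_isInput_add hsurj,
    FibreFold.fibreFoldCircuit_isSymmetric hp hC,
    FibreFold.fibreFoldCircuit_eval_output_add hsurj, Fintype.card_sum.le⟩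

/-- **Fibre products of symmetric circuits along an equivariant surjection.** For any group `Γ`
acting on the variables `X` and on finite index sets `Y`, `Y'`, and a `Γ`-equivariant surjection
`p : Y → Y'`: if a `Γ`-symmetric labelled circuit `C` over `K`, `X` computes `(g_y)_{y ∈ Y}`,
then the family of fibre products `(Π_{y : p y = y'} g_y)_{y' ∈ Y'}` is computed at outputs
indexed by `Y'` by a `Γ`-symmetric labelled circuit on at most `|G| + |Y'|` gates (one new `×`
gate per `y'` over the output gates of its fibre, `FibreFold.fibreFoldCircuit`; Dawar–Wilsenach
Defs. 2.2, 3.6, 3.7). [cite: DawarWilsenach2025, Def. 3.7] -/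
theorem IsSymmetric.exists_fibreProd {K : Type u} [CommSemiring K] {X : Type v} {Y : Type z}
    {Y' : Type t} [Fintype Y] [Fintype Y'] [DecidableEq Y'] {G : Type w} [Fintype G]
    {Γ : Type*} [Group Γ] [MulAction Γ X] [MulAction Γ Y] [MulAction Γ Y']
    {C : LabelledArithCircuit K X Y G} (hC : C.IsSymmetric Γ) (p : Y → Y')
    (hp : ∀ (γ : Γ) (y : Y), p (γ • y) = γ • p y) (hsurj : Function.Surjective p) :
    ∃ (G' : Type (max w t)) (_ : Fintype G') (C' : LabelledArithCircuit K X Y' G'),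
      C'.IsSymmetric Γ ∧
      (∀ y', C'.eval (C'.output y') =
        ∏ y ∈ Finset.univ.filter (fun y => p y = y'), C.eval (C.output y)) ∧
      Fintype.card G' ≤ Fintype.card G + Fintype.card Y' :=
  ⟨G ⊕ Y', inferInstance, FibreFold.fibreFoldCircuit C p .mul CircuitLabel.not_isInput_mul hsurj,
    FibreFold.fibreFoldCircuit_isSymmetric hp hC,
    FibreFold.fibreFoldCircuit_eval_output_mul hsurj, Fintype.card_sum.le⟩

end LabelledArithCircuit

end Literature.Computability.AlgebraicComplexity

end
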